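import Summits.Langlands.Langlands.Theses.CMFreeCompletedClosure

/-!
# Birth skeleton (BC3) for the crux `Visibility` — route `CMFreeCompletedClosure`, item stmt-Langlands-18470

Crux (fixed, the route's decl `Summit.Langlands.Langlands.Theses.CMFreeCompletedClosure.Visibility`):
for `E` totally complex, `n ≥ 1`, every L-algebraic cuspidal `π` of `GL_n(𝔸_E)`, every `ℓ` and
`ι : ℚ̄_ℓ ≃ ℂ`, some `ℤ̄_ℓ`-valued eigensystem `a` of the big Hecke algebra occurs in completed
cohomology of some tame level `𝒰` in some degree `i` (`TameLevel.EigensystemOccurs`: an eigenclass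
mod `ℓ^(t+1)` with exact annihilator, for every `t`) and satisfies the Hecke–Satake dictionary
`heckeFrobPoly n q_v (a v ·) = arithFrobPolyOfSatake ι q_v 1 α_v` at every `v ∉ 𝒰.bad`.

## The line (three registered stubs; the route's own two-layer plan "regular case via
Franke/Borel–Wallach + Emerton's comparison → congruence limit for irregular π", typed)

* `stub_visibility_regular` — the crux for `π` admitting a REGULAR L-algebraic infinity type
  (`∃ T, π.1.HasInfinityType T ∧ T.IsLAlgebraic ∧ T.IsRegular`; then `π^∨ ⊗ |det|^((n-1)/2)` is
  regular algebraic = cohomological): cuspidal cohomology with coefficients `V_λ(𝒪)` (Franke,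
  Borel–Wallach), integrality of the `T_{v,i}`-eigenvalues on Betti cohomology, `V_λ(𝒪/ℓ^s)`
  trivial on `U_r` for `r ≫ s` (Emerton's comparison / Hochschild–Serre), exact annihilator from a
  primitive lattice eigenvector.  In print in substance ([CalegariEmerton2011, §2], [Emerton2006,
  §2.2–2.3], [Scholze2015, §V.4]); XL to formalise.  BC5 plan-only rung of the route.
* `stub_irregular_congruences` — the OPEN kernel, typed as a congruence limit: for `π` with NO
  regular L-algebraic type there are ONE tame level `𝒰`, ONE degree `i` and an integral family `a`
  with the dictionary off `𝒰.bad` such that for every `t` some family `b ≡ a (mod ℓ^(t+1))` occurs in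
  `H̃^i(𝒰)` (e.g. the twisted eigensystem of a regular cuspidal `π_t ≡ π`: Deligne–Serre-type
  congruences in reverse, at bounded tame level).  Why it might fail = the crux's: beyond `GL_2`
  and holomorphic limits of discrete series no such congruences are known, and completed
  cohomology of `GL_n`, `n ≥ 3`, may miss irregular `π` ([arXiv:1306.2070, p. 3],
  [arXiv:1207.4224], [arXiv:1009.0785, Conj. 3.1.5]).
* `stub_occurs_of_congruences` — occurrence in `H̃^i(𝒰)` is closed under `ℓ`-adic congruence:
  if for every `t` some `b ≡ a (mod ℓ^(t+1))` occurs in degree `i`, then `a` occurs in degree `i`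
  (at stage `t` the eigenclass of `b` mod `ℓ^(t+1)` is an eigenclass for `a`, because `ℓ^(t+1)` kills
  `H^i(X_{U_r}, ℤ̄_ℓ/ℓ^(t+1))`; the exact-annihilator clause is unchanged).  M-sized, unconditional.

`Visibility_of` (kernel-checked, stubs used BY NAME, no `sorry` outside the stub bodies): case split on the
regular L-algebraic type; the irregular case is `stub_occurs_of_congruences` applied to the data of
`stub_irregular_congruences`.  (The same composition with the stub STATEMENTS as hypotheses — sorry-free
cone, axioms propext/Classical.choice/Quot.sound — is kept in the planner folder as `bc/Visibility_of_hyps.lean`;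
the registrar admits only by-name compositions in this file.)

Correction w.r.t. the pre-birth inlined skeleton (evidence `Visibility_birth_registered.lean`,
2026-08-17T16:51Z, same three stub NAMES): the case split there was on `π.1.IsRegularAlgebraic`
(= C-algebraic ∧ regular).  For EVEN `n` an L-algebraic `π` has integral archimedean exponents while
a C-algebraic type has exponents in `1/2 + ℤ`, so `IsLAlgebraic ∧ IsRegularAlgebraic` is never
satisfied and every regular L-algebraic `π` of `GL_{2m}` fell into the "irregular" stub.  The split
is now on the existence of a regular L-ALGEBRAIC infinity type (`T.IsLAlgebraic ∧ T.IsRegular`,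
`Literature.NumberTheory.Automorphic.InfinityType`), which is the regular/irregular dichotomy the
route header means (regularity of `π` = regularity of its C-algebraic twist).

Disproof used: none on file for this crux (`ledger crux ls stmt-Langlands-18470`: no `Disproof.lean`;
`ledger negatives --problem Langlands`: SplitPrimeInduction ×2, OrdinaryPrimeTransport,
K3KugaSatakeDescent — none concerns completed cohomology or visibility).
-/

namespace Summit.Langlands.Langlands.Cruxes.Visibility.Birth

/-- **Regular case** (BC5 plan-only rung): the crux for cuspidal `π` with a regular L-algebraic
infinity type — the twisted eigensystem of the cohomological representation `π^∨ ⊗ |det|^((n-1)/2)`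
occurs in completed cohomology of its own tame level with the Hecke–Satake dictionary off the bad
set.  Franke/Borel–Wallach + Emerton's comparison with classical cohomology of `V_λ(𝒪/ℓ^s)`;
[CalegariEmerton2011, §2], [Emerton2006, §2.2], [Scholze2015, §V.4], [Clozel1990, Thm. 3.13]. -/
theorem stub_visibility_regular :
    ∀ (E : Type) [Field E] [NumberField E], NumberField.IsTotallyComplex E → ∀ (n : ℕ), 0 < n → ∀
    (hcpt : Literature.NumberTheory.Automorphic.isCompact_glFiniteIntegralLevel n E) (π :
    Literature.NumberTheory.Automorphic.CuspidalAutomorphicRepData n E hcpt), π.1.IsLAlgebraic → (∃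
    T : Literature.NumberTheory.Automorphic.InfinityType E n, π.1.HasInfinityType T ∧ T.IsLAlgebraic
    ∧ T.IsRegular) → ∀ (ℓ : ℕ) [Fact ℓ.Prime] (ι : PadicAlgCl ℓ ≃+* ℂ), ∃ (𝒰 :
    Literature.NumberTheory.Automorphic.BigHeckeGLn.TameLevel n E ℓ) (i : ℕ) (a :
    IsDedekindDomain.HeightOneSpectrum (NumberField.RingOfIntegers E) → ℕ → (Valued.v : Valuation
    (PadicAlgCl ℓ) NNReal).valuationSubring), 𝒰.EigensystemOccurs (Valued.v : Valuation (PadicAlgCl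
    ℓ) NNReal).valuationSubring a i ∧ ∀ v ∉ 𝒰.bad, ∃ α : Multiset ℂ, π.1.HasSatakeParamAt v α ∧
    Literature.NumberTheory.Automorphic.BigHeckeGLn.heckeFrobPoly n (Ideal.absNorm v.asIdeal) (fun j
    => ((a v j : (Valued.v : Valuation (PadicAlgCl ℓ) NNReal).valuationSubring) : PadicAlgCl ℓ)) =
    Literature.NumberTheory.Automorphic.arithFrobPolyOfSatake ι v.residueCard 1 α := by
  sorry

/-- **Irregular case as a congruence limit** (the open kernel of the crux): an L-algebraic cuspidal
`π` with no regular L-algebraic infinity type has, at ONE tame level `𝒰` and ONE degree `i`, an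
`ℓ`-integral family `a` satisfying the Hecke–Satake dictionary off `𝒰.bad` which is, for every `t`,
congruent mod `ℓ^(t+1)` to a family `b` occurring in `H̃^i(𝒰)` (Deligne–Serre-type congruences to
cohomological eigensystems of bounded tame level, in reverse).  [arXiv:1306.2070, p. 3 and Conj. 1],
[arXiv:1207.4224, Conj. A], [arXiv:1009.0785, Conj. 3.1.5], [arXiv:1412.1533]. -/
theorem stub_irregular_congruences :
    ∀ (E : Type) [Field E] [NumberField E], NumberField.IsTotallyComplex E → ∀ (n : ℕ), 0 < n → ∀
    (hcpt : Literature.NumberTheory.Automorphic.isCompact_glFiniteIntegralLevel n E) (π :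
    Literature.NumberTheory.Automorphic.CuspidalAutomorphicRepData n E hcpt), π.1.IsLAlgebraic → ¬
    (∃ T : Literature.NumberTheory.Automorphic.InfinityType E n, π.1.HasInfinityType T ∧
    T.IsLAlgebraic ∧ T.IsRegular) → ∀ (ℓ : ℕ) [Fact ℓ.Prime] (ι : PadicAlgCl ℓ ≃+* ℂ), ∃ (𝒰 :
    Literature.NumberTheory.Automorphic.BigHeckeGLn.TameLevel n E ℓ) (i : ℕ) (a :
    IsDedekindDomain.HeightOneSpectrum (NumberField.RingOfIntegers E) → ℕ → (Valued.v : Valuation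
    (PadicAlgCl ℓ) NNReal).valuationSubring), (∀ v ∉ 𝒰.bad, ∃ α : Multiset ℂ, π.1.HasSatakeParamAt v
    α ∧ Literature.NumberTheory.Automorphic.BigHeckeGLn.heckeFrobPoly n (Ideal.absNorm v.asIdeal)
    (fun j => ((a v j : (Valued.v : Valuation (PadicAlgCl ℓ) NNReal).valuationSubring) : PadicAlgCl
    ℓ)) = Literature.NumberTheory.Automorphic.arithFrobPolyOfSatake ι v.residueCard 1 α) ∧ ∀ t : ℕ,
    ∃ b : IsDedekindDomain.HeightOneSpectrum (NumberField.RingOfIntegers E) → ℕ → (Valued.v :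
    Valuation (PadicAlgCl ℓ) NNReal).valuationSubring, 𝒰.EigensystemOccurs (Valued.v : Valuation
    (PadicAlgCl ℓ) NNReal).valuationSubring b i ∧ ∀ (v : IsDedekindDomain.HeightOneSpectrum
    (NumberField.RingOfIntegers E)) (j : ℕ), a v j - b v j ∈ Ideal.span {(((ℓ : ℕ) : (Valued.v :
    Valuation (PadicAlgCl ℓ) NNReal).valuationSubring)) ^ (t + 1)} := by
  sorry

/-- **Occurrence is closed under `ℓ`-adic congruence** (unconditional, M-sized): if for every `t`
some family `b ≡ a (mod ℓ^(t+1))` (at every place and index) occurs in `H̃^i` of the tame level `𝒰`,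
then `a` occurs in `H̃^i(𝒰)`: the stage-`t` eigenclass `c` of `b` in `H^i(X_{U_r}, ℤ̄_ℓ/ℓ^(t+1))`
satisfies `T_x c = b_x • c = a_x • c` since `(a_x - b_x) • c ∈ ℓ^(t+1) • H^i = 0`, and its annihilator
is untouched (`TameLevel.eigensystemOccurs_iff`). [folklore; CalegariEmerton2011, §8] -/
theorem stub_occurs_of_congruences :
    ∀ (E : Type) [Field E] [NumberField E] (n ℓ : ℕ) [Fact ℓ.Prime] (𝒰 :
    Literature.NumberTheory.Automorphic.BigHeckeGLn.TameLevel n E ℓ) (i : ℕ) (a :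
    IsDedekindDomain.HeightOneSpectrum (NumberField.RingOfIntegers E) → ℕ → (Valued.v : Valuation
    (PadicAlgCl ℓ) NNReal).valuationSubring), (∀ t : ℕ, ∃ b : IsDedekindDomain.HeightOneSpectrum
    (NumberField.RingOfIntegers E) → ℕ → (Valued.v : Valuation (PadicAlgCl ℓ)
    NNReal).valuationSubring, 𝒰.EigensystemOccurs (Valued.v : Valuation (PadicAlgCl ℓ)
    NNReal).valuationSubring b i ∧ ∀ (v : IsDedekindDomain.HeightOneSpectrum
    (NumberField.RingOfIntegers E)) (j : ℕ), a v j - b v j ∈ Ideal.span {(((ℓ : ℕ) : (Valued.v :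
    Valuation (PadicAlgCl ℓ) NNReal).valuationSubring)) ^ (t + 1)}) → 𝒰.EigensystemOccurs (Valued.v
    : Valuation (PadicAlgCl ℓ) NNReal).valuationSubring a i := by
  sorry

/-- **Composition, by name** (kernel-checked; no `sorry` in this proof — the only `sorry`s of the file
are the three stub bodies): the registered stubs imply the crux `Visibility` BY NAME.  Case split on the
existence of a regular L-algebraic infinity type; in the irregular case the congruence data of
`stub_irregular_congruences` are fed to `stub_occurs_of_congruences`.  (This is the theorem the skeleton
registrar reads: hypotheses = the declared stubs, used by name.) -/
theorem Visibility_of :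
    Summit.Langlands.Langlands.Theses.CMFreeCompletedClosure.Visibility := by
  intro E _ _ hE n hn hcpt π hπ ℓ _ ι
  by_cases hreg : ∃ T : Literature.NumberTheory.Automorphic.InfinityType E n,
      π.1.HasInfinityType T ∧ T.IsLAlgebraic ∧ T.IsRegular
  · exact stub_visibility_regular E hE n hn hcpt π hπ hreg ℓ ι
  · obtain ⟨𝒰, i, a, hdict, hcong⟩ := stub_irregular_congruences E hE n hn hcpt π hπ hreg ℓ ι
    exact ⟨𝒰, i, a, stub_occurs_of_congruences E n ℓ 𝒰 i a hcong, hdict⟩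

end Summit.Langlands.Langlands.Cruxes.Visibility.Birth
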